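import Literature.NumberTheory.GaloisCohomology.Howard2004.DVRSelmerATorsionControlProofs
import Literature.NumberTheory.GaloisCohomology.Howard2004.DVRKolyvaginBoundClosingProofs
import Literature.Algebra.Module.PowSmulImageLiftability
import HarnessLib

/-!
# Howard 2004, Lemma 1.6.3 («free image») and the «liftability» step of Lemma 1.6.4 on a `DVRSetting`:
# a reduced Selmer class killed by `π^j` is `π^{e_k - j}` times a Selmer class (theorems only)

Topic `NumberTheory/GaloisCohomology/Howard2004`; namespace
`Literature.NumberTheory.GaloisCohomology.Howard2004`.  THEOREMS ONLY: no definition, no named fact, no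
instance, no notation, no `sorry`.  Sequel to `DVRLevelTorsionControlProofs` / `DVRSelmerATorsionControlProofs`
(Lemma 1.3.3 on a `DVRSetting`: `H¹(K, inc)` injective, descent of `π^{e_k}`-torsion Selmer classes) and to
the algebra `Literature/Algebra/Module/PowSmulImageLiftability.lean`.

WHY (INPUTS row G87 = `Howard2004.thm161_dvrKolyvaginBound` = Howard Thm. 1.6.1; stub `stub_h161` of the μ-crux
stmt-BirchSwinnertonDyer-22642, binder `h161` of crux 23055's print-leaf census; cell `pub/bsd-print-x9`, seat
`bsd-line-x10b-p1-w7` g7, brick (LIFT)).  After `DVRKolyvaginBoundLevelwisePackageProofs` /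
`DVRLevelPairingPackageProofs` the verbatim conclusion `DVRSetting.Conclusion` of Thm. 1.6.1 is a kernel consequence of
the printed levelwise structure (Thm. 1.4.2) and of **Lemma 1.6.4 at `n = 1`** (`h164`).  The printed proof of
Lemma 1.6.4 (arXiv:1202.6340 p. 11 L82 – p. 12 L27) begins with the case `Stub^{(k)}(n) ≠ 0`:

> First suppose `Stub^{(k)}(n) ≠ 0`, so that in particular we are in the case `ε = 1`, and `λ^{(k)}(n) < k`.  Let
> `i = λ^{(k)}(n)`. … this is equivalent to `π^{k-i} κ_n^{(k)} = 0`.  Now by Lemma (liftability), `κ_n^{(k)}` is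
> divisible by `πⁱ` in `H¹_{𝓕(n)}(K, T^{(k)})`, proving this special case.

«Lemma (liftability)» is a dangling reference of the arXiv text; the step is **Lemma 1.6.3** (p. 11 L69–80):

> **Lemma 1.6.3.** If `n ∈ 𝓝^{(2k-1)}` and `Stub^{(k)}(n) ≠ 0` then the image of
> `H¹_{𝓕(n)}(K, T^{(2k-1)}) → H¹_{𝓕(n)}(K, T^{(k)})` is a free, rank-one `R^{(k)}`-submodule.  *Proof.* Under the
> identification `H¹_{𝓕(n)}(K,T^{(k)}) ≅ H¹_{𝓕(n)}(K,T^{(2k-1)})[𝔪ᵏ]` of Lemma (H.5 application), the above map is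
> identified with `π^{k-1}` …; `len_R(M^{(2k-1)}) < k` and `ε = 1`, hence the image is `≅ 𝔪^{k-1}R^{(2k-1)} ≅ R^{(k)}`.

applied to `κ_n^{(k)} = red(κ_n^{(2k-1)})`: in the free rank-one `R^{(k)}`-module `C = image`, an element killed by
`π^{k-i}` is divisible by `πⁱ`.  This file proves the step on a `DVRSetting` with H.0–H.5 for the UNMODIFIED structure
`𝓕` (`n = 1`, which is what `h164` consumes; the vocabulary for `𝓕(n)` on the tower is the assembler's), for two
levels `k ≤ k + d` in the tree's general exponents `e` (Howard `e_k = k`, `k + d = 2k - 1`):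

* §1 `AdicTower.incH1LE_apply_eq_scalarMapH1_pow_of_mem_limitH1` — for a compatible family `x ∈ lim_k H¹(K, T_k)`,
  `H¹(inc_{k→k+d})(x_k) = π^{e_{k+d}-e_k} x_{k+d}` (the tower identity `inc ∘ red = π^{e_{k+1}-e_k}`, iterated);
* §2 **`DVRSetting.exists_mem_selmerGroup_eq_scalarMapH1_pow_of_incH1LE_eq`** — THE LIFTABILITY STEP: given the
  printed structure `θ' : H¹_𝓕(K, T^{(k+d)}) ≃ R^{(k+d),ε} ⊕ M' ⊕ M'` (additive, `R`-equivariant, ANY `ε`) with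
  `π^{e_{k+d}-e_k} M' = 0` (Howard: `len M^{(2k-1)} ≤ k - 1`), a class `c ∈ H¹(K, T^{(k)})` in the image of the
  reduction of a Selmer class `c'` (`H¹(inc)(c) = π^{e_{k+d}-e_k} c'`) with `π^j c = 0`, `j ≤ e_k`, is
  `c = π^{e_k-j} y` for a SELMER class `y ∈ H¹_𝓕(K, T^{(k)})`;
* §3 `DVRSetting.exists_mem_selmerGroup_eq_scalarMapH1_pow_of_mem_limitSelmer` — the same for the `k`-th
  component of any `x ∈ H¹_𝓕(K, T) = lim`, and **`DVRSetting.KolyvaginSystem.exists_mem_selmerGroup_one_eq_pow_smul`**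
  — for `κ_1^{(k)}`: `π^{e_k - i} κ_1^{(k)} = 0`, `i ≤ e_k` ⟹ `κ_1^{(k)} ∈ πⁱ H¹_𝓕(K, T^{(k)})` (the printed sentence,
  `n = 1`);
* §4 `DVRSetting.exists_generator_redImage_of_package` — Lemma 1.6.3's conclusion itself for `ε = 1`: the classes
  `π^{e_{k+d}-e_k} c'`, `c'` Selmer at level `k + d` (= `H¹(inc)` of the image of the reduction), are the multiples of
  ONE of them whose annihilator is exactly `𝔪^{e_k}` («free of rank one over `R^{(k)}`»).

HONEST FRAMING: `thm161_dvrKolyvaginBound` is NOT proved here (Prop. 1.4.1 / Thm. 1.4.2 on the levels, Lemma 1.5.3,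
Lemmas 1.5.6–1.5.9, Lemma 1.6.2 and the induction of Lemma 1.6.4 over `n ∈ 𝓝` remain); no summit statement is proved;
the Birch–Swinnerton-Dyer conjecture is not proved by any of this.
References: [Howard2004HeegnerKolyvagin] Lemma 1.6.3, Lemma 1.6.4 (proof), Lemma 1.3.3, §1.6 (arXiv:1202.6340 p. 11
L69–80, p. 12 L1–9, p. 7 L152–160); [MazurRubinMemoirs2004] Lemma 3.5.4.
-/

set_option autoImplicit false

noncomputable section

open Function NumberField IsDedekindDomain Field
open scoped NumberField ContRepresentation

namespace Literature.NumberTheory.GaloisCohomology.Howard2004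

open Literature.NumberTheory.GaloisRepresentations
open Literature.NumberTheory.GaloisRepresentations.DiscreteGaloisModule
open Literature.NumberTheory.GaloisRepresentations.galoisCohomology

/-! ## §1 `H¹(inc_{k→k+d})(x_k) = π^{e_{k+d}-e_k} x_{k+d}` on a compatible family -/

namespace AdicTower

variable {K : Type} [Field K] [NumberField K] {R : Type} [CommRing R] [IsLocalRing R]
  {N : ℕ → Type} [∀ k, AddCommGroup (N k)] [∀ k, TopologicalSpace (N k)] [∀ k, DiscreteTopology (N k)]
  [∀ k, Module R (N k)]
  (T : AdicTower K R N) (π : R) (e : ℕ → ℕ)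
  (hkill : ∀ k, ∀ r ∈ IsLocalRing.maximalIdeal R ^ e k, ∀ x : N k, r • x = 0)
  (hker : ∀ k, LinearMap.ker (T.red k) = (IsLocalRing.maximalIdeal R ^ e k) • (⊤ : Submodule R (N (k + 1))))
  (hπ : π ∈ IsLocalRing.maximalIdeal R) (he : ∀ k, e k ≤ e (k + 1))

omit [NumberField K] in
/-- **`H¹(inc_{k→k+d})(x_k) = π^{e_{k+d}-e_k} · x_{k+d}` for a compatible family `x ∈ lim_k H¹(K, T_k)`**
(`red(x_{k+1}) = x_k`): the tower identity `H¹(inc_k) ∘ H¹(red_k) = π^{e_{k+1}-e_k}` (`incH1_redH1`) iterated along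
the family — the reduction `T^{(k+d)} ↠ T^{(k)}` read inside `T^{(k+d)}` through Lemma 1.3.3's `inc` is
multiplication by `π^{e_{k+d}-e_k}` (Howard: «the above map is identified with `π^{k-1}`»).
[cite: Howard2004HeegnerKolyvagin, Lemma 1.6.3 (proof) and §1.6 = arXiv:1202.6340 p. 11 L74–77; p. 12 L40–48] -/
theorem incH1LE_apply_eq_scalarMapH1_pow_of_mem_limitH1 {x : ∀ k, galoisCohomology (T.ρ k) 1}
    (hx : x ∈ T.limitH1) (k : ℕ) :
    ∀ d : ℕ, incH1LE T π e hkill hker hπ he k (k + d) (Nat.le_add_right k d) (x k) =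
      scalarMapH1 (T.ρ (k + d)) (T.hlin (k + d)) (π ^ (e (k + d) - e k)) (x (k + d))
  | 0 => by
    have h0 : incH1LE T π e hkill hker hπ he k (k + 0) (Nat.le_add_right k 0) = AddMonoidHom.id _ :=
      Nat.leRec_self _ _
    rw [h0, AddMonoidHom.id_apply]
    change x k = scalarMapH1 (T.ρ k) (T.hlin k) (π ^ (e k - e k)) (x k)
    rw [Nat.sub_self, pow_zero, scalarMapH1_one, AddMonoidHom.id_apply]
  | d + 1 => by
    have h1 : incH1LE T π e hkill hker hπ he k (k + (d + 1)) (Nat.le_add_right k (d + 1)) =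
        (incH1 T π e hkill hker hπ he (k + d)).comp
          (incH1LE T π e hkill hker hπ he k (k + d) (Nat.le_add_right k d)) :=
      Nat.leRec_succ _ _ (Nat.le_add_right k d)
    rw [h1, AddMonoidHom.comp_apply, incH1LE_apply_eq_scalarMapH1_pow_of_mem_limitH1 hx k d,
      incH1_scalarMapH1]
    have hxd : x (k + d) = T.redH1 (k + d) (x (k + d + 1)) := (hx (k + d)).symm
    rw [hxd, incH1_redH1, ← AddMonoidHom.comp_apply, ← scalarMapH1_mul, ← pow_add]
    have h2 : e k ≤ e (k + d) := (monotone_nat_of_le_succ he) (Nat.le_add_right k d)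
    have h3 : e (k + d) ≤ e (k + d + 1) := he (k + d)
    have hsum : e (k + d) - e k + (e (k + d + 1) - e (k + d)) = e (k + d + 1) - e k := by omega
    rw [hsum]
    rfl

end AdicTower

/-! ## §2 The liftability step on a `DVRSetting`: `π^j c = 0 ⟹ c = π^{e_k-j} · (Selmer class)` for `c` a reduced
Selmer class -/

namespace DVRSetting

variable {p : ℕ} [Fact p.Prime] {K : Type} [Field K] [NumberField K]
  {R : Type} [CommRing R] [IsDomain R] [IsDiscreteValuationRing R] [Algebra ℤ_[p] R]
  {N : ℕ → Type} [∀ k, AddCommGroup (N k)] [∀ k, TopologicalSpace (N k)]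
  [∀ k, DiscreteTopology (N k)] [∀ k, Module R (N k)]
  {Rk : ℕ → Type} [∀ k, CommRing (Rk k)] [∀ k, IsLocalRing (Rk k)] [∀ k, TopologicalSpace (Rk k)]
  [∀ k, DiscreteTopology (Rk k)] [∀ k, Algebra ℤ_[p] (Rk k)] [∀ k, Algebra R (Rk k)]
  [∀ k, Module (Rk k) (N k)] [∀ k, IsScalarTower R (Rk k) (N k)]
  {Nbar : Type} [AddCommGroup Nbar] [TopologicalSpace Nbar] [DiscreteTopology Nbar]
  [∀ k, Module (Rk k) Nbar]
  {Nq : ℕ → Finset (HeightOneSpectrum (𝓞 K)) → Type} [∀ k n, AddCommGroup (Nq k n)]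
  [∀ k n, TopologicalSpace (Nq k n)] [∀ k n, DiscreteTopology (Nq k n)]
  [∀ k n, Module (Rk k) (Nq k n)] [∀ k n, Module R (Nq k n)]
  [∀ k n, IsScalarTower R (Rk k) (Nq k n)]

/-- `𝔪^a = (π^a)` on a `DVRSetting` (`𝔪 = (π)`, `SatisfiesH.unif`). [cite: Howard2004HeegnerKolyvagin, §1.6 (arXiv p. 11, L13–14)] -/
theorem maximalIdeal_pow_eq_span_pow (S : DVRSetting p K R N Rk Nbar Nq) (hy : S.SatisfiesH) (a : ℕ) :
    IsLocalRing.maximalIdeal R ^ a = Ideal.span {S.π ^ a} := by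
  rw [hy.unif, Ideal.span_singleton_pow]

/-- **Howard 2004, the «liftability» step of Lemma 1.6.4 (= Lemma 1.6.3, «free image») on a `DVRSetting` with
H.0–H.5, levels `k ≤ k + d`.**  Data: the printed levelwise structure at level `k + d` in the shape of
`DVRKolyvaginBoundAssemblyProofs` — an additive `R`-equivariant bijection
`θ' : H¹_𝓕(K, T^{(k+d)}) ≃ (Fin ε → R/𝔪^{e_{k+d}}) × (M' × M')` (Thm. 1.4.2, any `ε`) — with `π^{e_{k+d}-e_k} M' = 0`
(Howard, `k + d = 2k - 1`: «`len_R(M^{(2k-1)}) < k`»).  Claim: if `c ∈ H¹(K, T^{(k)})` is the reduction of a Selmer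
class `c' ∈ H¹_𝓕(K, T^{(k+d)})` — read through Lemma 1.3.3's injective `H¹(inc_{k→k+d})` as
`H¹(inc)(c) = π^{e_{k+d}-e_k} c'` — and `π^j c = 0` with `j ≤ e_k`, then `c = π^{e_k-j} y` for a Selmer class
`y ∈ H¹_𝓕(K, T^{(k)})`.  Proof = the print's: inside `(Fin ε → R/𝔪^{e_{k+d}}) × (M' × M')` the image of `π^{e_{k+d}-e_k}`
is `(Fin ε → 𝔪^{e_{k+d}-e_k}/𝔪^{e_{k+d}}) × 0`, free over `R/𝔪^{e_k}`, where `π^j`-torsion is divisible by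
`π^{e_k-j}` (`Literature.Algebra.Module.exists_eq_pow_smul_pow_smul_of_pow_smul_eq_zero`); the quotient `π^{e_k-j}`-th
root `π^{e_{k+d}-e_k} c₂` is a Selmer class killed by `π^{e_k}`, hence `= H¹(inc)(y)` with `y` Selmer at level `k`
(Lemma 1.3.3, `exists_mem_selmerGroup_incH1LE_eq`), and `H¹(inc)` is injective (`incH1LE_injective`).  In print
(`j = k - i`): «`π^{k-i} κ_n^{(k)} = 0` … `κ_n^{(k)}` is divisible by `πⁱ` in `H¹_{𝓕(n)}(K, T^{(k)})`».
[cite: Howard2004HeegnerKolyvagin, Lemma 1.6.3 and Lemma 1.6.4 (proof) = arXiv:1202.6340 p. 11 L69–80; p. 12 L1–9]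
[cite: MazurRubinMemoirs2004, Lemma 3.5.4] -/
theorem exists_mem_selmerGroup_eq_scalarMapH1_pow_of_incH1LE_eq (S : DVRSetting p K R N Rk Nbar Nq)
    (hy : S.SatisfiesH) (hπm : S.π ∈ IsLocalRing.maximalIdeal R) (hle : ∀ k, S.e k ≤ S.e (k + 1))
    (k d : ℕ) {ε : ℕ} {M' : Type} [AddCommGroup M'] [Module R M']
    (θ' : ↥(((S.t (k + d)).cond).selmerGroup) ≃+
      ((Fin ε → R ⧸ IsLocalRing.maximalIdeal R ^ S.e (k + d)) × (M' × M')))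
    (hθ' : ∀ (r : R) (y : galoisCohomology (S.T.ρ (k + d)) 1)
      (hy' : y ∈ ((S.t (k + d)).cond).selmerGroup),
      θ' ⟨scalarMapH1 (S.T.ρ (k + d)) (S.T.hlin (k + d)) r y, S.scalarMapH1_mem_selmerGroup hy (k + d) r hy'⟩ =
        r • θ' ⟨y, hy'⟩)
    (hM' : ∀ m : M', S.π ^ (S.e (k + d) - S.e k) • m = 0)
    {c : galoisCohomology (S.T.ρ k) 1} {c' : galoisCohomology (S.T.ρ (k + d)) 1}
    (hc' : c' ∈ ((S.t (k + d)).cond).selmerGroup)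
    (hcc' : AdicTower.incH1LE S.T S.π S.e hy.killed hy.ker_red hπm hle k (k + d) (Nat.le_add_right k d) c =
      scalarMapH1 (S.T.ρ (k + d)) (S.T.hlin (k + d)) (S.π ^ (S.e (k + d) - S.e k)) c')
    {j : ℕ} (hj : j ≤ S.e k) (h0 : scalarMapH1 (S.T.ρ k) (S.T.hlin k) (S.π ^ j) c = 0) :
    ∃ y ∈ ((S.t k).cond).selmerGroup, c = scalarMapH1 (S.T.ρ k) (S.T.hlin k) (S.π ^ (S.e k - j)) y := by
  have hka : S.e k ≤ S.e (k + d) := hy.e_strictMono.monotone (Nat.le_add_right k d)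
  -- θ' is injective on underlying classes
  have hθinj : ∀ (y₁ y₂ : galoisCohomology (S.T.ρ (k + d)) 1) (h₁ : y₁ ∈ ((S.t (k + d)).cond).selmerGroup)
      (h₂ : y₂ ∈ ((S.t (k + d)).cond).selmerGroup), θ' ⟨y₁, h₁⟩ = θ' ⟨y₂, h₂⟩ → y₁ = y₂ := by
    intro y₁ y₂ h₁ h₂ h
    exact Subtype.ext_iff.1 (θ'.injective h)
  -- (i) `π^j · π^{e_{k+d}-e_k} · θ'(c') = 0`
  have hsel : scalarMapH1 (S.T.ρ (k + d)) (S.T.hlin (k + d)) (S.π ^ (S.e (k + d) - S.e k)) c' ∈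
      ((S.t (k + d)).cond).selmerGroup := S.scalarMapH1_mem_selmerGroup hy (k + d) _ hc'
  have hzero : scalarMapH1 (S.T.ρ (k + d)) (S.T.hlin (k + d)) (S.π ^ j)
      (scalarMapH1 (S.T.ρ (k + d)) (S.T.hlin (k + d)) (S.π ^ (S.e (k + d) - S.e k)) c') = 0 := by
    rw [← hcc']
    have h := DFunLike.congr_fun
      (AdicTower.scalarMapH1_comp_incH1LE S.T S.π S.e hy.killed hy.ker_red hπm hle (S.π ^ j) k (k + d)
        (Nat.le_add_right k d)) c
    simp only [AddMonoidHom.comp_apply] at h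
    rw [h, h0, map_zero]
  have h1 : S.π ^ j • S.π ^ (S.e (k + d) - S.e k) • θ' ⟨c', hc'⟩ = 0 := by
    rw [← hθ' _ c' hc', ← hθ' _ _ hsel]
    have hz : (⟨scalarMapH1 (S.T.ρ (k + d)) (S.T.hlin (k + d)) (S.π ^ j)
        (scalarMapH1 (S.T.ρ (k + d)) (S.T.hlin (k + d)) (S.π ^ (S.e (k + d) - S.e k)) c'),
        S.scalarMapH1_mem_selmerGroup hy (k + d) _ hsel⟩ : ↥(((S.t (k + d)).cond).selmerGroup)) = 0 :=
      Subtype.ext hzero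
    rw [hz, map_zero]
  -- (ii) the algebra of Lemma 1.6.3: divisibility by `π^{e_k - j}` inside the image of `π^{e_{k+d}-e_k}`
  have hdj : S.e (k + d) - S.e k + j ≤ S.e (k + d) := by omega
  obtain ⟨w, hw⟩ := Literature.Algebra.Module.exists_eq_pow_smul_pow_smul_of_pow_smul_eq_zero
    (S.π_ne_zero hy) (S.maximalIdeal_pow_eq_span_pow hy (S.e (k + d))) hdj
    (LinearEquiv.refl R ((Fin ε → R ⧸ IsLocalRing.maximalIdeal R ^ S.e (k + d)) × (M' × M')))
    (fun q => by rw [Prod.smul_mk, hM', hM', Prod.mk_zero_zero] ) (θ' ⟨c', hc'⟩) h1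
  have hexp : S.e (k + d) - (S.e (k + d) - S.e k) - j = S.e k - j := by omega
  rw [hexp] at hw
  -- (iii) `π^{e_{k+d}-e_k} c₂` (with `θ' c₂ = w`) is a Selmer class killed by `π^{e_k}`: descend it to level `k`
  set c₂ : ↥(((S.t (k + d)).cond).selmerGroup) := θ'.symm w with hc₂
  have hc₂sel : scalarMapH1 (S.T.ρ (k + d)) (S.T.hlin (k + d)) (S.π ^ (S.e (k + d) - S.e k)) (c₂ : _) ∈
      ((S.t (k + d)).cond).selmerGroup := S.scalarMapH1_mem_selmerGroup hy (k + d) _ c₂.2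
  have hc₂kill : scalarMapH1 (S.T.ρ (k + d)) (S.T.hlin (k + d)) (S.π ^ S.e k)
      (scalarMapH1 (S.T.ρ (k + d)) (S.T.hlin (k + d)) (S.π ^ (S.e (k + d) - S.e k)) (c₂ : _)) = 0 := by
    rw [← AddMonoidHom.comp_apply, ← scalarMapH1_mul, ← pow_add, Nat.add_sub_cancel' hka]
    exact S.scalarMapH1_pow_eq_zero_of_le hy (k + d) le_rfl _
  obtain ⟨y, hysel, hy_eq⟩ := S.exists_mem_selmerGroup_incH1LE_eq hy hπm hle k d _ hc₂sel hc₂kill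
  -- (iv) compare through `θ'` and the injective `H¹(inc_{k→k+d})`
  refine ⟨y, hysel, S.incH1LE_injective hy hπm hle k (k + d) (Nat.le_add_right k d) ?_⟩
  have hinc : AdicTower.incH1LE S.T S.π S.e hy.killed hy.ker_red hπm hle k (k + d) (Nat.le_add_right k d)
      (scalarMapH1 (S.T.ρ k) (S.T.hlin k) (S.π ^ (S.e k - j)) y) =
      scalarMapH1 (S.T.ρ (k + d)) (S.T.hlin (k + d)) (S.π ^ (S.e k - j))
        (scalarMapH1 (S.T.ρ (k + d)) (S.T.hlin (k + d)) (S.π ^ (S.e (k + d) - S.e k)) (c₂ : _)) := by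
    have h := DFunLike.congr_fun
      (AdicTower.scalarMapH1_comp_incH1LE S.T S.π S.e hy.killed hy.ker_red hπm hle (S.π ^ (S.e k - j)) k (k + d)
        (Nat.le_add_right k d)) y
    simp only [AddMonoidHom.comp_apply] at h
    rw [← h, hy_eq]
  rw [hinc, hcc']
  refine hθinj _ _ hsel (S.scalarMapH1_mem_selmerGroup hy (k + d) _ hc₂sel) ?_
  rw [hθ' _ c' hc', hw, hθ' _ _ hc₂sel, hθ' _ _ c₂.2]
  congr 2
  rw [hc₂]
  exact (θ'.apply_symm_apply w).symm

/-! ## §3 The same for compatible families (`H¹_𝓕(K, T) = lim`) and for `κ_1` -/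

/-- **The liftability step for the `k`-th component of `x ∈ H¹_𝓕(K, T) = lim_k H¹_𝓕(K, T^{(k)})`**: with the level
structure `θ'` at a level `k + d` where `π^{e_{k+d}-e_k}` kills `M'`, `π^j x_k = 0` (`j ≤ e_k`) ⟹ `x_k = π^{e_k-j} y`
with `y ∈ H¹_𝓕(K, T^{(k)})` — §2 with `c' = x_{k+d}` (`H¹(inc)(x_k) = π^{e_{k+d}-e_k} x_{k+d}`, §1).
[cite: Howard2004HeegnerKolyvagin, Lemma 1.6.3 and Lemma 1.6.4 (proof) = arXiv:1202.6340 p. 11 L69–80; p. 12 L1–9] -/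
theorem exists_mem_selmerGroup_eq_scalarMapH1_pow_of_mem_limitSelmer (S : DVRSetting p K R N Rk Nbar Nq)
    (hy : S.SatisfiesH) (k d : ℕ) {ε : ℕ} {M' : Type} [AddCommGroup M'] [Module R M']
    (θ' : ↥(((S.t (k + d)).cond).selmerGroup) ≃+
      ((Fin ε → R ⧸ IsLocalRing.maximalIdeal R ^ S.e (k + d)) × (M' × M')))
    (hθ' : ∀ (r : R) (y : galoisCohomology (S.T.ρ (k + d)) 1)
      (hy' : y ∈ ((S.t (k + d)).cond).selmerGroup),
      θ' ⟨scalarMapH1 (S.T.ρ (k + d)) (S.T.hlin (k + d)) r y, S.scalarMapH1_mem_selmerGroup hy (k + d) r hy'⟩ =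
        r • θ' ⟨y, hy'⟩)
    (hM' : ∀ m : M', S.π ^ (S.e (k + d) - S.e k) • m = 0)
    {x : ∀ k, galoisCohomology (S.T.ρ k) 1} (hx : x ∈ S.T.limitSelmer fun k => (S.t k).cond)
    {j : ℕ} (hj : j ≤ S.e k) (h0 : scalarMapH1 (S.T.ρ k) (S.T.hlin k) (S.π ^ j) (x k) = 0) :
    ∃ y ∈ ((S.t k).cond).selmerGroup, x k = scalarMapH1 (S.T.ρ k) (S.T.hlin k) (S.π ^ (S.e k - j)) y := by
  rw [AdicTower.mem_limitSelmer_iff] at hx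
  exact S.exists_mem_selmerGroup_eq_scalarMapH1_pow_of_incH1LE_eq hy (S.pi_mem_maximalIdeal hy) (S.e_le_succ hy)
    k d θ' hθ' hM' (hx.2 (k + d))
    (AdicTower.incH1LE_apply_eq_scalarMapH1_pow_of_mem_limitH1 S.T S.π S.e hy.killed hy.ker_red
      (S.pi_mem_maximalIdeal hy) (S.e_le_succ hy) (x := x) hx.1 k d) hj h0

/-- **Howard 2004, proof of Lemma 1.6.4, the case `Stub^{(k)}(n) ≠ 0` at `n = 1`, its «liftability» sentence**:
for a Kolyvagin system `κ` of a `DVRSetting` with H.0–H.5 and the printed level structure `θ'` at a level `k + d`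
with `π^{e_{k+d}-e_k} M' = 0` (Howard: level `2k - 1`, `len M^{(2k-1)} < k`), if `π^{e_k-i} κ_1^{(k)} = 0` (`i ≤ e_k`)
then `κ_1^{(k)} = πⁱ y` for a Selmer class `y ∈ H¹_𝓕(K, T^{(k)})` — «`κ_n^{(k)}` is divisible by `πⁱ` in
`H¹_{𝓕(n)}(K, T^{(k)})`» for `n = 1` (`κ_1 ∈ H¹_𝓕(K, T) = lim`, `KolyvaginSystem.one_mem`).
[cite: Howard2004HeegnerKolyvagin, Lemma 1.6.4 (proof) and Lemma 1.6.3 = arXiv:1202.6340 p. 12 L1–9; p. 11 L69–80] -/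
theorem KolyvaginSystem.exists_mem_selmerGroup_one_eq_pow_smul {S : DVRSetting p K R N Rk Nbar Nq}
    (κ : S.KolyvaginSystem) (hy : S.SatisfiesH) (k d : ℕ) {ε : ℕ} {M' : Type} [AddCommGroup M'] [Module R M']
    (θ' : ↥(((S.t (k + d)).cond).selmerGroup) ≃+
      ((Fin ε → R ⧸ IsLocalRing.maximalIdeal R ^ S.e (k + d)) × (M' × M')))
    (hθ' : ∀ (r : R) (y : galoisCohomology (S.T.ρ (k + d)) 1)
      (hy' : y ∈ ((S.t (k + d)).cond).selmerGroup),
      θ' ⟨scalarMapH1 (S.T.ρ (k + d)) (S.T.hlin (k + d)) r y, S.scalarMapH1_mem_selmerGroup hy (k + d) r hy'⟩ =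
        r • θ' ⟨y, hy'⟩)
    (hM' : ∀ m : M', S.π ^ (S.e (k + d) - S.e k) • m = 0)
    {i : ℕ} (hi : i ≤ S.e k) (h0 : scalarMapH1 (S.T.ρ k) (S.T.hlin k) (S.π ^ (S.e k - i)) (κ.one k) = 0) :
    ∃ y ∈ ((S.t k).cond).selmerGroup, κ.one k = scalarMapH1 (S.T.ρ k) (S.T.hlin k) (S.π ^ i) y := by
  have h := S.exists_mem_selmerGroup_eq_scalarMapH1_pow_of_mem_limitSelmer hy k d θ' hθ' hM' κ.one_mem
    (Nat.sub_le _ _) h0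
  rwa [Nat.sub_sub_self hi] at h

/-! ## §4 Lemma 1.6.3 itself (`ε = 1`): the reduced image is free of rank one over `R^{(k)} = R/𝔪^{e_k}` -/

/-- **Howard 2004, Lemma 1.6.3 («free image») on a `DVRSetting`, `ε = 1`:** with the printed structure `θ'` at level
`k + d` (`ε = 1`, `π^{e_{k+d}-e_k} M' = 0`), the classes `π^{e_{k+d}-e_k} c'`, `c' ∈ H¹_𝓕(K, T^{(k+d)})` — i.e. the image
of the reduction `H¹_𝓕(K, T^{(k+d)}) → H¹_𝓕(K, T^{(k)})` read in level `k + d` through Lemma 1.3.3's injective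
`H¹(inc)` — are the `R`-multiples of ONE such class `g` whose annihilator is EXACTLY `𝔪^{e_k}`: «the image … is a
free, rank-one `R^{(k)}`-submodule», «isomorphic as an `R`-module to `𝔪^{k-1}R^{(2k-1)} ≅ R^{(k)}`».
[cite: Howard2004HeegnerKolyvagin, Lemma 1.6.3 = arXiv:1202.6340 Lemma 2.6.3, p. 11 L69–80] -/
theorem exists_generator_redImage_of_package (S : DVRSetting p K R N Rk Nbar Nq) (hy : S.SatisfiesH)
    (k d : ℕ) {M' : Type} [AddCommGroup M'] [Module R M']
    (θ' : ↥(((S.t (k + d)).cond).selmerGroup) ≃+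
      ((Fin 1 → R ⧸ IsLocalRing.maximalIdeal R ^ S.e (k + d)) × (M' × M')))
    (hθ' : ∀ (r : R) (y : galoisCohomology (S.T.ρ (k + d)) 1)
      (hy' : y ∈ ((S.t (k + d)).cond).selmerGroup),
      θ' ⟨scalarMapH1 (S.T.ρ (k + d)) (S.T.hlin (k + d)) r y, S.scalarMapH1_mem_selmerGroup hy (k + d) r hy'⟩ =
        r • θ' ⟨y, hy'⟩)
    (hM' : ∀ m : M', S.π ^ (S.e (k + d) - S.e k) • m = 0) :
    ∃ g ∈ ((S.t (k + d)).cond).selmerGroup,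
      (∃ c₀ ∈ ((S.t (k + d)).cond).selmerGroup,
        g = scalarMapH1 (S.T.ρ (k + d)) (S.T.hlin (k + d)) (S.π ^ (S.e (k + d) - S.e k)) c₀) ∧
      (∀ c' ∈ ((S.t (k + d)).cond).selmerGroup, ∃ r : R,
        scalarMapH1 (S.T.ρ (k + d)) (S.T.hlin (k + d)) (S.π ^ (S.e (k + d) - S.e k)) c' =
          scalarMapH1 (S.T.ρ (k + d)) (S.T.hlin (k + d)) r g) ∧
      ∀ r : R, scalarMapH1 (S.T.ρ (k + d)) (S.T.hlin (k + d)) r g = 0 ↔ r ∈ IsLocalRing.maximalIdeal R ^ S.e k := by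
  have hka : S.e k ≤ S.e (k + d) := hy.e_strictMono.monotone (Nat.le_add_right k d)
  have hθinj : ∀ (y₁ y₂ : galoisCohomology (S.T.ρ (k + d)) 1) (h₁ : y₁ ∈ ((S.t (k + d)).cond).selmerGroup)
      (h₂ : y₂ ∈ ((S.t (k + d)).cond).selmerGroup), θ' ⟨y₁, h₁⟩ = θ' ⟨y₂, h₂⟩ → y₁ = y₂ := by
    intro y₁ y₂ h₁ h₂ h
    exact Subtype.ext_iff.1 (θ'.injective h)
  obtain ⟨c, ⟨u₀, hcu₀⟩, hgen, hann⟩ := Literature.Algebra.Module.exists_generator_pow_smul_of_linearEquiv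
    (S.π_ne_zero hy) (S.maximalIdeal_pow_eq_span_pow hy (S.e (k + d))) (Nat.sub_le (S.e (k + d)) (S.e k))
    (LinearEquiv.refl R ((Fin 1 → R ⧸ IsLocalRing.maximalIdeal R ^ S.e (k + d)) × (M' × M')))
    (fun q => by rw [Prod.smul_mk, hM', hM', Prod.mk_zero_zero])
  have hexp : S.e (k + d) - (S.e (k + d) - S.e k) = S.e k := by omega
  rw [hexp] at hann
  -- `g := π^{e_{k+d}-e_k} · θ'⁻¹(u₀)`, so that `θ' g = c`
  set c₀ : ↥(((S.t (k + d)).cond).selmerGroup) := θ'.symm u₀ with hc₀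
  have hθc₀ : θ' ⟨(c₀ : _), c₀.2⟩ = u₀ := by rw [Subtype.coe_eta, hc₀]; exact θ'.apply_symm_apply u₀
  have hgsel : scalarMapH1 (S.T.ρ (k + d)) (S.T.hlin (k + d)) (S.π ^ (S.e (k + d) - S.e k)) (c₀ : _) ∈
      ((S.t (k + d)).cond).selmerGroup := S.scalarMapH1_mem_selmerGroup hy (k + d) _ c₀.2
  have hθg : θ' ⟨_, hgsel⟩ = c := by rw [hθ' _ _ c₀.2, hθc₀, hcu₀]
  refine ⟨_, hgsel, ⟨(c₀ : _), c₀.2, rfl⟩, fun c' hc' => ?_, fun r => ?_⟩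
  · obtain ⟨r, hr⟩ := hgen (θ' ⟨c', hc'⟩)
    refine ⟨r, hθinj _ _ (S.scalarMapH1_mem_selmerGroup hy (k + d) _ hc')
      (S.scalarMapH1_mem_selmerGroup hy (k + d) _ hgsel) ?_⟩
    rw [hθ' _ _ hc', hr, hθ' _ _ hgsel, hθg]
  · rw [S.maximalIdeal_pow_eq_span_pow hy, ← hann r, ← hθg, ← hθ' _ _ hgsel]
    constructor
    · intro h
      have hz : (⟨scalarMapH1 (S.T.ρ (k + d)) (S.T.hlin (k + d)) r
          (scalarMapH1 (S.T.ρ (k + d)) (S.T.hlin (k + d)) (S.π ^ (S.e (k + d) - S.e k)) (c₀ : _)),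
          S.scalarMapH1_mem_selmerGroup hy (k + d) _ hgsel⟩ : ↥(((S.t (k + d)).cond).selmerGroup)) = 0 :=
        Subtype.ext h
      rw [hz, map_zero]
    · intro h
      have hz := (map_eq_zero_iff θ' θ'.injective).1 h
      exact Subtype.ext_iff.1 hz

/-! ## §5 The same for ANY family of Selmer structures on the tower having Lemma 1.3.3's descent
(e.g. Howard's `𝓕(n)` on the levels `T^{(k)}`, `I_n T^{(k)} = 0`, once its control is in the tree) -/

/-- **The liftability step for an arbitrary family of Selmer structures `F_k` on the levels** (the shape in
which Lemma 1.6.4 uses it: `𝓕(n)` on `T^{(k)}` and `T^{(2k-1)}`, `n ∈ 𝓝^{(2k-1)}`).  Hypotheses on `F`: the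
Selmer groups are `R`-stable (`hFsmul`; Def. 1.1.1 «`R`-submodule») and Lemma 1.3.3's DESCENT between the
levels `k ≤ k + d` (`hdesc`: a Selmer class at level `k + d` killed by `π^{e_k}` is `H¹(inc)` of a Selmer
class at level `k` — for `F = 𝓕` this is `DVRSetting.exists_mem_selmerGroup_incH1LE_eq`, and §2 is the
instance).  Data and claim as in §2: `θ' : H¹_{F}(K, T^{(k+d)}) ≃ (Fin ε → R/𝔪^{e_{k+d}}) × (M' × M')` additive
`R`-equivariant with `π^{e_{k+d}-e_k} M' = 0`; `H¹(inc)(c) = π^{e_{k+d}-e_k} c'` with `c'` Selmer; `π^j c = 0`,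
`j ≤ e_k` ⟹ `c = π^{e_k-j} y` with `y ∈ H¹_{F}(K, T^{(k)})`.
[cite: Howard2004HeegnerKolyvagin, Lemma 1.6.3 and Lemma 1.6.4 (proof) = arXiv:1202.6340 p. 11 L69–80; p. 12 L1–9]
[cite: MazurRubinMemoirs2004, Lemma 3.5.4] -/
theorem exists_mem_selmerGroup_eq_scalarMapH1_pow_of_incH1LE_eq_of_descent (S : DVRSetting p K R N Rk Nbar Nq)
    (hy : S.SatisfiesH) (hπm : S.π ∈ IsLocalRing.maximalIdeal R) (hle : ∀ k, S.e k ≤ S.e (k + 1))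
    (k d : ℕ) (F : ∀ k, SelmerStructure (S.T.ρ k))
    (hFsmul : ∀ (i : ℕ) (r : R) (y : galoisCohomology (S.T.ρ i) 1), y ∈ (F i).selmerGroup →
      scalarMapH1 (S.T.ρ i) (S.T.hlin i) r y ∈ (F i).selmerGroup)
    (hdesc : ∀ c ∈ (F (k + d)).selmerGroup,
      scalarMapH1 (S.T.ρ (k + d)) (S.T.hlin (k + d)) (S.π ^ S.e k) c = 0 →
        ∃ c₀ ∈ (F k).selmerGroup,
          AdicTower.incH1LE S.T S.π S.e hy.killed hy.ker_red hπm hle k (k + d) (Nat.le_add_right k d) c₀ = c)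
    {ε : ℕ} {M' : Type} [AddCommGroup M'] [Module R M']
    (θ' : ↥((F (k + d)).selmerGroup) ≃+ ((Fin ε → R ⧸ IsLocalRing.maximalIdeal R ^ S.e (k + d)) × (M' × M')))
    (hθ' : ∀ (r : R) (y : galoisCohomology (S.T.ρ (k + d)) 1) (hy' : y ∈ (F (k + d)).selmerGroup),
      θ' ⟨scalarMapH1 (S.T.ρ (k + d)) (S.T.hlin (k + d)) r y, hFsmul (k + d) r y hy'⟩ = r • θ' ⟨y, hy'⟩)
    (hM' : ∀ m : M', S.π ^ (S.e (k + d) - S.e k) • m = 0)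
    {c : galoisCohomology (S.T.ρ k) 1} {c' : galoisCohomology (S.T.ρ (k + d)) 1}
    (hc' : c' ∈ (F (k + d)).selmerGroup)
    (hcc' : AdicTower.incH1LE S.T S.π S.e hy.killed hy.ker_red hπm hle k (k + d) (Nat.le_add_right k d) c =
      scalarMapH1 (S.T.ρ (k + d)) (S.T.hlin (k + d)) (S.π ^ (S.e (k + d) - S.e k)) c')
    {j : ℕ} (hj : j ≤ S.e k) (h0 : scalarMapH1 (S.T.ρ k) (S.T.hlin k) (S.π ^ j) c = 0) :
    ∃ y ∈ (F k).selmerGroup, c = scalarMapH1 (S.T.ρ k) (S.T.hlin k) (S.π ^ (S.e k - j)) y := by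
  have hka : S.e k ≤ S.e (k + d) := hy.e_strictMono.monotone (Nat.le_add_right k d)
  have hθinj : ∀ (y₁ y₂ : galoisCohomology (S.T.ρ (k + d)) 1) (h₁ : y₁ ∈ (F (k + d)).selmerGroup)
      (h₂ : y₂ ∈ (F (k + d)).selmerGroup), θ' ⟨y₁, h₁⟩ = θ' ⟨y₂, h₂⟩ → y₁ = y₂ := by
    intro y₁ y₂ h₁ h₂ h
    exact Subtype.ext_iff.1 (θ'.injective h)
  have hsel : scalarMapH1 (S.T.ρ (k + d)) (S.T.hlin (k + d)) (S.π ^ (S.e (k + d) - S.e k)) c' ∈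
      (F (k + d)).selmerGroup := hFsmul (k + d) _ c' hc'
  have hzero : scalarMapH1 (S.T.ρ (k + d)) (S.T.hlin (k + d)) (S.π ^ j)
      (scalarMapH1 (S.T.ρ (k + d)) (S.T.hlin (k + d)) (S.π ^ (S.e (k + d) - S.e k)) c') = 0 := by
    rw [← hcc']
    have h := DFunLike.congr_fun
      (AdicTower.scalarMapH1_comp_incH1LE S.T S.π S.e hy.killed hy.ker_red hπm hle (S.π ^ j) k (k + d)
        (Nat.le_add_right k d)) c
    simp only [AddMonoidHom.comp_apply] at h
    rw [h, h0, map_zero]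
  have h1 : S.π ^ j • S.π ^ (S.e (k + d) - S.e k) • θ' ⟨c', hc'⟩ = 0 := by
    rw [← hθ' _ c' hc', ← hθ' _ _ hsel]
    have hz : (⟨scalarMapH1 (S.T.ρ (k + d)) (S.T.hlin (k + d)) (S.π ^ j)
        (scalarMapH1 (S.T.ρ (k + d)) (S.T.hlin (k + d)) (S.π ^ (S.e (k + d) - S.e k)) c'),
        hFsmul (k + d) _ _ hsel⟩ : ↥((F (k + d)).selmerGroup)) = 0 :=
      Subtype.ext hzero
    rw [hz, map_zero]
  have hdj : S.e (k + d) - S.e k + j ≤ S.e (k + d) := by omega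
  obtain ⟨w, hw⟩ := Literature.Algebra.Module.exists_eq_pow_smul_pow_smul_of_pow_smul_eq_zero
    (S.π_ne_zero hy) (S.maximalIdeal_pow_eq_span_pow hy (S.e (k + d))) hdj
    (LinearEquiv.refl R ((Fin ε → R ⧸ IsLocalRing.maximalIdeal R ^ S.e (k + d)) × (M' × M')))
    (fun q => by rw [Prod.smul_mk, hM', hM', Prod.mk_zero_zero]) (θ' ⟨c', hc'⟩) h1
  have hexp : S.e (k + d) - (S.e (k + d) - S.e k) - j = S.e k - j := by omega
  rw [hexp] at hw
  set c₂ : ↥((F (k + d)).selmerGroup) := θ'.symm w with hc₂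
  have hc₂sel : scalarMapH1 (S.T.ρ (k + d)) (S.T.hlin (k + d)) (S.π ^ (S.e (k + d) - S.e k)) (c₂ : _) ∈
      (F (k + d)).selmerGroup := hFsmul (k + d) _ _ c₂.2
  have hc₂kill : scalarMapH1 (S.T.ρ (k + d)) (S.T.hlin (k + d)) (S.π ^ S.e k)
      (scalarMapH1 (S.T.ρ (k + d)) (S.T.hlin (k + d)) (S.π ^ (S.e (k + d) - S.e k)) (c₂ : _)) = 0 := by
    rw [← AddMonoidHom.comp_apply, ← scalarMapH1_mul, ← pow_add, Nat.add_sub_cancel' hka]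
    exact S.scalarMapH1_pow_eq_zero_of_le hy (k + d) le_rfl _
  obtain ⟨y, hysel, hy_eq⟩ := hdesc _ hc₂sel hc₂kill
  refine ⟨y, hysel, S.incH1LE_injective hy hπm hle k (k + d) (Nat.le_add_right k d) ?_⟩
  have hinc : AdicTower.incH1LE S.T S.π S.e hy.killed hy.ker_red hπm hle k (k + d) (Nat.le_add_right k d)
      (scalarMapH1 (S.T.ρ k) (S.T.hlin k) (S.π ^ (S.e k - j)) y) =
      scalarMapH1 (S.T.ρ (k + d)) (S.T.hlin (k + d)) (S.π ^ (S.e k - j))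
        (scalarMapH1 (S.T.ρ (k + d)) (S.T.hlin (k + d)) (S.π ^ (S.e (k + d) - S.e k)) (c₂ : _)) := by
    have h := DFunLike.congr_fun
      (AdicTower.scalarMapH1_comp_incH1LE S.T S.π S.e hy.killed hy.ker_red hπm hle (S.π ^ (S.e k - j)) k (k + d)
        (Nat.le_add_right k d)) y
    simp only [AddMonoidHom.comp_apply] at h
    rw [← h, hy_eq]
  rw [hinc, hcc']
  refine hθinj _ _ hsel (hFsmul (k + d) _ _ hc₂sel) ?_
  rw [hθ' _ c' hc', hw, hθ' _ _ hc₂sel, hθ' _ _ c₂.2]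
  congr 2
  rw [hc₂]
  exact (θ'.apply_symm_apply w).symm

end DVRSetting

end Literature.NumberTheory.GaloisCohomology.Howard2004

end
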